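import Literature.NumberTheory.PAdicHodge.KummerTraceOneElement
import HarnessLib

/-!
# Kummer depth: renormalising a Kummer generator to depth `→ p/(p-1)` in an almost-perfectoid field
# (toward Tate's almost étale lemma, Tate 1967 §3.2 Prop. 9 / Berger–Colmez (TS1))

Let `E` be an ultrametric normed field with `0 < ‖p‖ < 1` and `M ⊆ E` a subfield with the
**almost-perfectoid package** (both proved for `M = K_∞ = ℚ_p(μ_{p^∞}) ⊆ F̄` in
`CyclotomicTowerPthPowers`):

* (Γ) the value group of `M` is `p`-divisible: every `x ∈ M^×` has `c ∈ M` with `‖c‖ ^ p = ‖x‖`;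
* (U_s) for some `s > 0`: every `u ∈ M`, `‖u‖ ≤ 1`, has `w ∈ M` with `‖u - w ^ p‖ ≤ ‖p‖ ^ s`.

Then every `a ∈ M^×` can be renormalised by `p`-th powers to be as close to `1` as any depth short
of `p/(p-1)`:

* `TateAlmostEtale.exists_mul_pow_depth_step` : ONE PUSHING STEP — if `‖a - 1‖ ≤ ‖p‖^d` (`d > 0`) there is
  a unit `b ∈ M` with `‖a b^p - 1‖ ≤ ‖p‖^{min (d + s) (1 + d/p)}` (take `x ∈ M` with `x^p ≡ a - 1` to relative
  precision `p^s`, then `a/(1+x)^p - 1 = O(p^{d+s}) + O(p x) = O(p^{min(d+s, 1+d/p)})`);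
* `TateAlmostEtale.exists_mul_pow_depth_iter` : the iteration `d ↦ min (d+s) (1+d/p)` climbs to the fixed
  point `p/(p-1)`: after `k` steps the depth is `≥ min (p/(p-1) - ε) (d₀ + k δ)`, `δ = min s (ε (p-1)/p)`;
* `TateAlmostEtale.exists_mul_pow_norm_sub_one_le` : **for every `a ∈ M^×` and every `D < p/(p-1)` there is
  `b ∈ M^×` with `‖a b^p - 1‖ ≤ ‖p‖^D`.**

Since `X^p - a` and `X^p - a b^p` define the same extension of `M`, this renormalises any Kummer
generator of a cyclic degree-`p` extension `M(α)/M` to `α' = α b` with `α'^p = 1 + t`, `v_p(t) ≥ D`;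
the explicit trace-one element of `KummerTraceOneElement` then has valuation `≥ D(p-1)/p - 1 → 0⁻`:
`Tr_{M(α)/M}(p^{-ε} 𝓞) ∋ 1`, i.e. Tate's almost étale lemma for such extensions (file
`TateAlmostEtaleKummerStep`). Own elementary route to the statement of Tate 1967 §3.2 Prop. 9 =
Berger–Colmez 2008 Prop. 4.1.1 (TS1); no differents, no ramification theory. No `sorry`, no definitions.

References: J. Tate, *p-divisible groups* (1967) §3.2 Prop. 9 [Tate1967]; L. Berger, P. Colmez,
Astérisque 319 (2008), Déf. 3.1.3 (TS1), Prop. 4.1.1 [BergerColmez2008]; for the almost-perfectoid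
package compare O. Gabber, L. Ramero, *Almost ring theory*, LNM 1800, §6.6 (deeply ramified ⇔ Frobenius
surjective on `𝓞/p`) [GabberRamero2003].
-/

noncomputable section

namespace Literature.NumberTheory.PAdicHodge

namespace TateAlmostEtale

variable {E : Type*} [NormedField E] [IsUltrametricDist E] (M : Subfield E) {p : ℕ}

/-- For `‖x‖ < 1`: `‖1 + x‖ = 1`. [folklore] -/
private theorem norm_one_add_of_lt {x : E} (hx : ‖x‖ < 1) : ‖1 + x‖ = 1 := by
  have h := IsUltrametricDist.norm_add_eq_max_of_norm_ne_norm (x := (1 : E)) (y := x)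
    (by rw [norm_one]; exact hx.ne')
  rw [h, norm_one, max_eq_left hx.le]

/-- `‖p‖^{min y z}` dominates both `‖p‖^y` and `‖p‖^z` (`0 < ‖p‖ ≤ 1`). [folklore] -/
private theorem max_rpow_le_rpow_min {q : ℝ} (hq0 : 0 < q) (hq1 : q ≤ 1) (y z : ℝ) :
    max (q ^ y) (q ^ z) ≤ q ^ min y z :=
  max_le (Real.rpow_le_rpow_of_exponent_ge hq0 hq1 (min_le_left _ _))
    (Real.rpow_le_rpow_of_exponent_ge hq0 hq1 (min_le_right _ _))

/-- **One pushing step.** Under the almost-perfectoid package (Γ), (U_s) (`s ≥ 0`) of `M`: if `a ∈ M`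
has `‖a - 1‖ ≤ ‖p‖^d` with `d > 0`, there is a unit `b ∈ M` with
`‖a b^p - 1‖ ≤ ‖p‖ ^ min (d + s) (1 + d/p)`. Proof: `t = a - 1 = c^p t'`, `‖t'‖ = 1`, `t' = w^p + O(p^s)`,
`x = c w`, so `x^p = t + O(p^s t)`, `(1+x)^p = 1 + x^p + O(p x)` and `b = (1+x)⁻¹`. Degree-`p` step of
Tate's almost étale lemma. [cite: Tate1967, §3.2 Prop. 9] [cite: BergerColmez2008, Prop. 4.1.1] -/
theorem exists_mul_pow_depth_step (hp : p.Prime) (hp0 : (p : E) ≠ 0) (hp1 : ‖(p : E)‖ < 1)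
    {s : ℝ} (hs : 0 ≤ s) (hΓ : ∀ x ∈ M, x ≠ 0 → ∃ c ∈ M, ‖c‖ ^ p = ‖x‖)
    (hU : ∀ u ∈ M, ‖u‖ ≤ 1 → ∃ w ∈ M, ‖u - w ^ p‖ ≤ ‖(p : E)‖ ^ s)
    {a : E} (ha : a ∈ M) {d : ℝ} (hd : 0 < d) (had : ‖a - 1‖ ≤ ‖(p : E)‖ ^ d) :
    ∃ b ∈ M, ‖b‖ = 1 ∧ ‖a * b ^ p - 1‖ ≤ ‖(p : E)‖ ^ min (d + s) (1 + d / p) := by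
  set q : ℝ := ‖(p : E)‖ with hq
  have hq0 : 0 < q := norm_pos_iff.mpr hp0
  have hpr : (0 : ℝ) < p := by exact_mod_cast hp.pos
  have hqs1 : q ^ s ≤ 1 := Real.rpow_le_one hq0.le hp1.le hs
  set t : E := a - 1 with ht
  by_cases ht0 : t = 0
  · refine ⟨1, one_mem M, norm_one, ?_⟩
    rw [one_pow, mul_one, ← ht, ht0, norm_zero]
    exact Real.rpow_nonneg hq0.le _
  have htM : t ∈ M := sub_mem ha (one_mem M)
  have htlt : ‖t‖ < 1 := had.trans_lt (Real.rpow_lt_one hq0.le hp1 hd)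
  -- `t = c^p t'`, `‖t'‖ = 1`
  obtain ⟨c, hcM, hc⟩ := hΓ t htM ht0
  have hc0 : c ≠ 0 := by
    intro h; rw [h, norm_zero, zero_pow hp.ne_zero] at hc
    exact ht0 (norm_eq_zero.mp hc.symm)
  have hcp0 : c ^ p ≠ 0 := pow_ne_zero _ hc0
  set t' : E := t / c ^ p with ht'
  have ht'1 : ‖t'‖ = 1 := by
    rw [ht', norm_div, norm_pow, hc, div_self (norm_ne_zero_iff.mpr ht0)]
  obtain ⟨w, hwM, hw⟩ := hU t' (div_mem htM (pow_mem hcM p)) ht'1.le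
  -- `x = c w`: `x^p - t = c^p (w^p - t')`
  set x : E := c * w with hx
  have hxM : x ∈ M := mul_mem hcM hwM
  have hxt : ‖x ^ p - t‖ ≤ ‖t‖ * q ^ s := by
    have : x ^ p - t = c ^ p * (w ^ p - t') := by
      rw [hx, mul_pow, ht', mul_sub, mul_div_cancel₀ _ hcp0]
    rw [this, norm_mul, norm_pow, hc, norm_sub_rev]
    rw [norm_sub_rev] at hw
    exact mul_le_mul_of_nonneg_left hw (norm_nonneg _)
  have hxp : ‖x‖ ^ p ≤ ‖t‖ := by
    rw [← norm_pow]
    have : x ^ p = (x ^ p - t) + t := by ring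
    rw [this]
    refine (IsUltrametricDist.norm_add_le_max _ _).trans (max_le ?_ le_rfl)
    exact hxt.trans (mul_le_of_le_one_right (norm_nonneg _) hqs1)
  have hx1 : ‖x‖ < 1 := by
    rcases lt_or_ge ‖x‖ 1 with h | h
    · exact h
    exfalso
    have : (1 : ℝ) ≤ ‖x‖ ^ p := one_le_pow₀ h
    linarith
  -- `‖x‖ ≤ ‖t‖^{1/p} ≤ q^{d/p}`
  have hxq : ‖x‖ ≤ q ^ (d / p) := by
    have h1 : ‖x‖ = (‖x‖ ^ p) ^ ((p : ℝ)⁻¹) :=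
      (Real.pow_rpow_inv_natCast (norm_nonneg _) hp.ne_zero).symm
    rw [h1]
    calc (‖x‖ ^ p) ^ ((p : ℝ)⁻¹) ≤ ‖t‖ ^ ((p : ℝ)⁻¹) :=
          Real.rpow_le_rpow (pow_nonneg (norm_nonneg _) _) hxp (inv_nonneg.mpr hpr.le)
      _ ≤ (q ^ d) ^ ((p : ℝ)⁻¹) := Real.rpow_le_rpow (norm_nonneg _) had (inv_nonneg.mpr hpr.le)
      _ = q ^ (d / p) := by rw [← Real.rpow_mul hq0.le, div_eq_mul_inv]
  have hR : ‖(1 + x) ^ p - 1 - x ^ p‖ ≤ q * ‖x‖ := KummerTrace.norm_one_add_pow_sub_le hp x hx1.le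
  have hkey : ‖a - (1 + x) ^ p‖ ≤ q ^ min (d + s) (1 + d / p) := by
    have : a - (1 + x) ^ p = (t - x ^ p) + (-((1 + x) ^ p - 1 - x ^ p)) := by rw [ht]; ring
    rw [this]
    refine (IsUltrametricDist.norm_add_le_max _ _).trans ?_
    refine le_trans (max_le_max ?_ ?_) (max_rpow_le_rpow_min hq0 hp1.le _ _)
    · rw [norm_sub_rev]
      calc ‖x ^ p - t‖ ≤ ‖t‖ * q ^ s := hxt
        _ ≤ q ^ d * q ^ s := by gcongr
        _ = q ^ (d + s) := (Real.rpow_add hq0 d s).symm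
    · rw [norm_neg]
      calc ‖(1 + x) ^ p - 1 - x ^ p‖ ≤ q * ‖x‖ := hR
        _ ≤ q * q ^ (d / p) := by gcongr
        _ = q ^ (1 + d / p) := by rw [Real.rpow_add hq0, Real.rpow_one]
  -- `b = (1 + x)⁻¹`
  have h1x : ‖1 + x‖ = 1 := norm_one_add_of_lt hx1
  have h1x0 : (1 + x) ≠ 0 := norm_pos_iff.mp (by rw [h1x]; exact one_pos)
  refine ⟨(1 + x)⁻¹, inv_mem (add_mem (one_mem M) hxM), by rw [norm_inv, h1x, inv_one], ?_⟩
  have hmul : (1 + x) ^ p * (1 + x)⁻¹ ^ p = 1 := by rw [← mul_pow, mul_inv_cancel₀ h1x0, one_pow]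
  have : a * (1 + x)⁻¹ ^ p - 1 = (a - (1 + x) ^ p) * (1 + x)⁻¹ ^ p := by rw [sub_mul, hmul]
  rw [this, norm_mul, norm_pow, norm_inv, h1x, inv_one, one_pow, mul_one]
  exact hkey

/-- **The iteration.** Under (Γ), (U_s) with `s > 0`: if `‖a - 1‖ ≤ ‖p‖^{d₀}` (`d₀ > 0`) then for
`0 < ε < p/(p-1)` and every `k` there is a unit `b ∈ M` with
`‖a b^p - 1‖ ≤ ‖p‖ ^ min (p/(p-1) - ε) (d₀ + k δ)`, `δ = min s (ε (p-1)/p)`: each pushing step gains at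
least `δ` until the depth is within `ε` of the fixed point `p/(p-1)` of `d ↦ 1 + d/p`.
[cite: Tate1967, §3.2 Prop. 9] [cite: BergerColmez2008, Prop. 4.1.1] -/
theorem exists_mul_pow_depth_iter (hp : p.Prime) (hp0 : (p : E) ≠ 0) (hp1 : ‖(p : E)‖ < 1)
    {s : ℝ} (hs : 0 < s) (hΓ : ∀ x ∈ M, x ≠ 0 → ∃ c ∈ M, ‖c‖ ^ p = ‖x‖)
    (hU : ∀ u ∈ M, ‖u‖ ≤ 1 → ∃ w ∈ M, ‖u - w ^ p‖ ≤ ‖(p : E)‖ ^ s)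
    {a : E} (ha : a ∈ M) {d₀ : ℝ} (hd₀ : 0 < d₀) (had : ‖a - 1‖ ≤ ‖(p : E)‖ ^ d₀)
    {ε : ℝ} (hε : 0 < ε) (hεL : ε < (p : ℝ) / (p - 1)) (k : ℕ) :
    ∃ b ∈ M, ‖b‖ = 1 ∧ ‖a * b ^ p - 1‖ ≤
      ‖(p : E)‖ ^ min ((p : ℝ) / (p - 1) - ε) (d₀ + k * min s (ε * (p - 1) / p)) := by
  set q : ℝ := ‖(p : E)‖ with hq
  have hq0 : 0 < q := norm_pos_iff.mpr hp0
  have hpr : (1 : ℝ) < p := by exact_mod_cast hp.one_lt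
  set L : ℝ := (p : ℝ) / (p - 1) with hL
  set δ : ℝ := min s (ε * (p - 1) / p) with hδ
  have hδ0 : 0 < δ := lt_min hs (by rw [hδ] at *; positivity)
  have hLmul : L * (p - 1) = p := by rw [hL]; exact div_mul_cancel₀ _ (by linarith)
  induction k with
  | zero =>
    refine ⟨1, one_mem M, norm_one, ?_⟩
    rw [one_pow, mul_one, Nat.cast_zero, zero_mul, add_zero]
    exact had.trans (Real.rpow_le_rpow_of_exponent_ge hq0 hp1.le (min_le_right _ _))
  | succ k ih =>
    obtain ⟨b, hbM, hb1, hb⟩ := ih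
    set Dk : ℝ := min (L - ε) (d₀ + k * δ) with hDk
    have hDkpos : 0 < Dk := lt_min (sub_pos.mpr hεL) (by positivity)
    obtain ⟨b', hb'M, hb'1, hb'⟩ := exists_mul_pow_depth_step M hp hp0 hp1 hs.le hΓ hU
      (mul_mem ha (pow_mem hbM p)) hDkpos hb
    refine ⟨b * b', mul_mem hbM hb'M, by rw [norm_mul, hb1, hb'1, mul_one], ?_⟩
    have hab : a * (b * b') ^ p = a * b ^ p * b' ^ p := by rw [mul_pow, mul_assoc]
    rw [hab]
    refine hb'.trans (Real.rpow_le_rpow_of_exponent_ge hq0 hp1.le ?_)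
    -- `min (L-ε) (d₀ + (k+1) δ) ≤ min (Dk + s) (1 + Dk/p)`
    have hDkle : Dk ≤ L - ε := min_le_left _ _
    have hδs : δ ≤ s := min_le_left _ _
    have hδε : δ ≤ ε * (p - 1) / p := min_le_right _ _
    have h1 : min (L - ε) (d₀ + (((k + 1 : ℕ)) : ℝ) * δ) ≤ Dk + δ := by
      rcases le_total (L - ε) (d₀ + k * δ) with h | h
      · rw [hDk, min_eq_left h]
        exact (min_le_left _ _).trans (by linarith)
      · rw [hDk, min_eq_right h]
        refine (min_le_right _ _).trans (le_of_eq ?_)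
        push_cast; ring
    refine le_min (h1.trans (by linarith)) (h1.trans ?_)
    -- `Dk + δ ≤ 1 + Dk/p`: `p δ ≤ ε (p-1) ≤ p - Dk (p-1)`
    have hp0r : (0 : ℝ) < p := by linarith
    have hδp : δ * p ≤ ε * (p - 1) := (le_div_iff₀ hp0r).mp hδε
    have hDk2 : Dk * (p - 1) ≤ (L - ε) * (p - 1) :=
      mul_le_mul_of_nonneg_right hDkle (by linarith)
    rw [← sub_nonneg]
    have : 1 + Dk / p - (Dk + δ) = (p - Dk * (p - 1) - δ * p) / p := by
      field_simp; ring
    rw [this]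
    exact div_nonneg (by nlinarith) hp0r.le

/-- **Kummer depth.** Let `M ⊆ E` be a subfield of an ultrametric normed field with `0 < ‖p‖ < 1`
(`p` prime) satisfying the almost-perfectoid package: (Γ) `p`-divisible value group and (U_s), `s > 0`,
every integer is a `p`-th power modulo `p^s`. Then **for every `a ∈ M^×` and every `D < p/(p-1)` there is
`b ∈ M^×` with `‖a b^p - 1‖ ≤ ‖p‖^D`**: Kummer generators can be renormalised to any depth short of the
unramified threshold `p/(p-1)`. With `M = K_∞` (package: `CyclotomicTowerPthPowers`) this is the
arithmetic heart of the degree-`p` step of Tate's almost étale lemma.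
[cite: Tate1967, §3.2 Prop. 9] [cite: BergerColmez2008, Prop. 4.1.1] -/
theorem exists_mul_pow_norm_sub_one_le (hp : p.Prime) (hp0 : (p : E) ≠ 0) (hp1 : ‖(p : E)‖ < 1)
    {s : ℝ} (hs : 0 < s) (hΓ : ∀ x ∈ M, x ≠ 0 → ∃ c ∈ M, ‖c‖ ^ p = ‖x‖)
    (hU : ∀ u ∈ M, ‖u‖ ≤ 1 → ∃ w ∈ M, ‖u - w ^ p‖ ≤ ‖(p : E)‖ ^ s)
    {a : E} (ha : a ∈ M) (ha0 : a ≠ 0) {D : ℝ} (hD : D < (p : ℝ) / (p - 1)) :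
    ∃ b ∈ M, b ≠ 0 ∧ ‖a * b ^ p - 1‖ ≤ ‖(p : E)‖ ^ D := by
  set q : ℝ := ‖(p : E)‖ with hq
  have hq0 : 0 < q := norm_pos_iff.mpr hp0
  have hqs1 : q ^ s < 1 := Real.rpow_lt_one hq0.le hp1 hs
  -- normalise: `a = c^p a'`, `‖a'‖ = 1`, `a' = w^p + O(p^s)`, `a₁ = a / (c w)^p`
  obtain ⟨c, hcM, hc⟩ := hΓ a ha ha0
  have hc0 : c ≠ 0 := by
    intro h; rw [h, norm_zero, zero_pow hp.ne_zero] at hc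
    exact ha0 (norm_eq_zero.mp hc.symm)
  have hcp0 : c ^ p ≠ 0 := pow_ne_zero _ hc0
  set a' : E := a / c ^ p with ha'
  have ha'1 : ‖a'‖ = 1 := by
    rw [ha', norm_div, norm_pow, hc, div_self (norm_ne_zero_iff.mpr ha0)]
  obtain ⟨w, hwM, hw⟩ := hU a' (div_mem ha (pow_mem hcM p)) ha'1.le
  have hwp1 : ‖w ^ p‖ = 1 := by
    have h : ‖a' + -(w ^ p)‖ < max ‖a'‖ ‖-(w ^ p)‖ := by
      rw [← sub_eq_add_neg, ha'1]
      exact (hw.trans_lt hqs1).trans_le (le_max_left _ _)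
    have := IsUltrametricDist.norm_eq_of_add_norm_lt_max h
    rw [norm_neg, ha'1] at this
    exact this.symm
  have hw0 : w ≠ 0 := by
    intro h; rw [h, zero_pow hp.ne_zero, norm_zero] at hwp1; exact zero_ne_one hwp1
  set b₀ : E := (c * w)⁻¹ with hb₀
  have hb₀M : b₀ ∈ M := inv_mem (mul_mem hcM hwM)
  have hb₀0 : b₀ ≠ 0 := inv_ne_zero (mul_ne_zero hc0 hw0)
  have hab₀ : a * b₀ ^ p = a' / w ^ p := by
    rw [hb₀, ha', inv_pow, mul_pow, div_div, div_eq_mul_inv]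
  have hdepth₀ : ‖a * b₀ ^ p - 1‖ ≤ q ^ s := by
    rw [hab₀, div_sub_one (pow_ne_zero _ hw0), norm_div, hwp1, div_one]
    exact hw
  rcases le_or_gt D s with hDs | hDs
  · exact ⟨b₀, hb₀M, hb₀0, hdepth₀.trans (Real.rpow_le_rpow_of_exponent_ge hq0 hp1.le hDs)⟩
  -- iterate from depth `s` with `ε = p/(p-1) - D`
  set L : ℝ := (p : ℝ) / (p - 1) with hL
  have hε : 0 < L - D := sub_pos.mpr hD
  have hεL : L - D < L := by linarith
  set δ : ℝ := min s ((L - D) * (p - 1) / p) with hδ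
  have hpr : (1 : ℝ) < p := by exact_mod_cast hp.one_lt
  have hδ0 : 0 < δ := lt_min hs (by rw [hδ] at *; exact div_pos (mul_pos hε (by linarith)) (by linarith))
  obtain ⟨b, hbM, hb1, hb⟩ := exists_mul_pow_depth_iter M hp hp0 hp1 hs hΓ hU
    (mul_mem ha (pow_mem hb₀M p)) hs hdepth₀ hε hεL ⌈(D - s) / δ⌉₊
  refine ⟨b₀ * b, mul_mem hb₀M hbM, mul_ne_zero hb₀0 (norm_pos_iff.mp (by rw [hb1]; exact one_pos)),
    ?_⟩
  have hab : a * (b₀ * b) ^ p = a * b₀ ^ p * b ^ p := by rw [mul_pow, mul_assoc]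
  rw [hab]
  refine hb.trans (Real.rpow_le_rpow_of_exponent_ge hq0 hp1.le (le_min (by rw [hL]; linarith) ?_))
  -- `D ≤ s + ⌈(D-s)/δ⌉ δ`
  have hk : (D - s) / δ ≤ (⌈(D - s) / δ⌉₊ : ℝ) := Nat.le_ceil _
  have : D - s ≤ (⌈(D - s) / δ⌉₊ : ℝ) * δ := by
    rw [div_le_iff₀ hδ0] at hk; exact hk
  rw [← hδ]
  linarith

end TateAlmostEtale

end Literature.NumberTheory.PAdicHodge

end
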